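import Literature.MathematicalPhysics.QuantumFieldTheory.OSPositivityEuclid
import HarnessLib

/-!
# Wightman positivity from reflection positivity, II: the OS kernel on the tube

Sequel to `OSPositivityEuclid`: **Step 2 of the Glaser route** to
`Literature.MathematicalPhysics.QuantumFieldTheory.OS1973_positiveDefinite`. The OS kernel
`𝕂 (⟨p, z⟩, ⟨q, w⟩) = 𝔚ext_{p+q}(revConj z, w)` of an E1–E2 Schwinger family with holomorphic
continuations `𝔚ₙ`, known to be positive-semidefinite on time-ordered Euclidean points
(`isPosSemidefKernelOn_osKernel_euclidPts`), is positive-semidefinite on all **mixed points**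
`M(y, τ)_k = (τ_k + i y⁰_k, y⃗_k)` with `y` time-ordered and arbitrary real times `τ`
(`isPosSemidefKernelOn_osKernel_mixedPts`) — in particular on the rays `x + i t η` along which
the boundary values are taken (file `WightmanPositivityProofs`). This is V. Glaser's statement
that OS positivity "holds in the whole causal domain" of the analytically continued Schwinger
functions (Comm. Math. Phys. 37 (1974), §2), here for the real-spatial slice of the tube, which is
all that the boundary values need.

## Proof (induction over the Osterwalder–Schrader time-difference variables)

In the variables `u_k = y⁰_k − i τ_k` (so that the complex time is `i u_k`) and
`δ_k = u_k − u_{k-1}` the mixed points with `y` time-ordered are exactly `Re δ_k > 0`, the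
Euclidean points are `δ_k ∈ (0, ∞)`, and `𝕂` is anti-holomorphic in the `δ`'s of its first
argument, holomorphic in those of the second. Let `𝒫_r` be the mixed points whose `δ_k` are real
for `k ≥ r` (`succDiff τ k = 0` for `k ≥ r`; `𝒫_0` = Euclidean points). Complexifying `δ_r` alone
— the **stage points** `pt_r(P, s) = M(y, τ) + i (s − δ_r) 𝟙_{k ≥ r} ê₀` — exhibits `𝒫_{r+1}`
inside the image of `𝒫_r`-parameters `× {Re s > 0}`, the real `s > 0` landing in `𝒫_r`, and the
pair kernel `(s̄, s') ↦ 𝕂(pt_r(P, conj s̄), pt_r(P', s'))` is `𝔚ext` of an affine function of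
`(s̄, s')` ranging in the relative tube, hence has bounded double Taylor expansions
(`hasLocalTaylor₂_comp_affine`). Glaser's lemma
(`Literature.Analysis.Complex.isPosSemidefKernelOn_halfPlane_of_ofReal`) carries positivity from
`𝒫_r` to `𝒫_{r+1}`; every finite family of mixed points lies in some `𝒫_r`.

## References

* V. Glaser, Comm. Math. Phys. 37 (1974) 257–272, §2. [GlaserCMP1974]
* K. Osterwalder, R. Schrader, Comm. Math. Phys. 31 (1973) 83–112, §4.1–4.3.
  [OsterwalderSchraderCMP1973]
-/

noncomputable section

open MeasureTheory Filter Complex ComplexConjugate Metric Set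
open scoped Topology ComplexOrder SchwartzMap BigOperators
open Literature.MathematicalPhysics.QuantumLattice Literature.Analysis.Complex

namespace Literature.MathematicalPhysics.QuantumFieldTheory

variable {d : ℕ}

/-! ### Sequences with positive successive differences -/

section SuccDiff

variable {n : ℕ}

/-- A real sequence with positive successive differences (first term included) is strictly
increasing and positive. [folklore] -/
theorem strictMono_and_pos_of_succDiff_pos {t : Fin n → ℝ} (h : ∀ k, 0 < succDiff t k) :
    StrictMono t ∧ ∀ k, 0 < t k := by
  cases n with
  | zero => exact ⟨Subsingleton.strictMono _, fun k => k.elim0⟩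
  | succ m =>
    have hmono : StrictMono t := by
      refine Fin.strictMono_iff_lt_succ.2 fun i => ?_
      have := h i.succ
      rw [succDiff_succ] at this
      linarith
    have h0 : 0 < t 0 := by simpa using h 0
    exact ⟨hmono, fun k => h0.trans_le (hmono.monotone (Fin.zero_le k))⟩

/-- In the time-ordered region all successive time differences are positive (a private copy of
the lemma of the same statement in `OSTimeTubeIntegrability`, to keep the import closure small). [folklore] -/
private theorem succDiff_time_pos {x : Fin n → EuclideanSpace ℝ (Fin (d + 1))}
    (hx : x ∈ timeOrderedRegion d n) (k : Fin n) : 0 < succDiff (fun i => x i 0) k := by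
  cases n with
  | zero => exact k.elim0
  | succ m =>
    refine Fin.cases ?_ (fun j => ?_) k
    · simpa using hx.1 0
    · rw [succDiff_succ]; exact sub_pos.2 (hx.2 (Fin.castSucc_lt_succ))

/-- A sequence all of whose successive differences vanish is zero. [folklore] -/
theorem eq_zero_of_succDiff_eq_zero {τ : Fin n → ℝ} (h : ∀ k, succDiff τ k = 0) : τ = 0 := by
  cases n with
  | zero => exact funext fun k => k.elim0
  | succ m =>
    funext k
    induction k using Fin.induction with
    | zero => simpa using h 0
    | succ i ih =>
      have := h i.succ
      rw [succDiff_succ, sub_eq_zero] at this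
      rw [Pi.zero_apply] at ih ⊢
      rw [this, ih]

/-- A sequence whose successive differences vanish from index `r` on is constant from index
`r - 1` on: `τ k = τ j` whenever `r ≤ j + 1`, `j ≤ k`. [folklore] -/
theorem apply_eq_of_succDiff_eq_zero {τ : Fin n → ℝ} {r : ℕ}
    (h : ∀ k : Fin n, r ≤ (k : ℕ) → succDiff τ k = 0) {j k : Fin n} (hjk : j ≤ k)
    (hj : r ≤ (j : ℕ) + 1) : τ k = τ j := by
  cases n with
  | zero => exact j.elim0
  | succ m =>
    suffices H : ∀ e : ℕ, ∀ k : Fin (m + 1), (k : ℕ) = j + e → τ k = τ j from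
      H (k - j) k (by rw [Fin.le_def] at hjk; omega)
    intro e
    induction e with
    | zero => intro k hk; exact congrArg τ (Fin.ext (by omega))
    | succ e ih =>
      intro k hk
      obtain ⟨i, rfl⟩ : ∃ i : Fin m, k = i.succ :=
        ⟨k.pred (fun h0 => by simp [h0] at hk), by simp⟩
      rw [Fin.val_succ] at hk
      have h1 := h i.succ (by rw [Fin.val_succ]; omega)
      rw [succDiff_succ, sub_eq_zero] at h1
      rw [h1]
      exact ih i.castSucc (by rw [Fin.val_castSucc]; omega)

end SuccDiff

/-! ### Mixed points and stage points -/

section Mixed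

variable {p : ℕ}

/-- The **mixed point** `M(y, τ) ∈ (ℂ^{1+d})^p` with Euclidean data `y` (Euclidean times `y⁰_k`
and spatial coordinates `y⃗_k`) and real Minkowski times `τ`: `M(y, τ)_k = (τ_k + i y⁰_k, y⃗_k)`.
For `τ = 0` this is the Euclidean point `ι y`; for `y⁰_k = t (k+1)`, `τ_k = x⁰_k`, `y⃗_k = x⃗_k`
it is the ray point `x + i t η`, `η_k = (k+1) ê₀` (Glaser (1974) §2: the real-spatial slice of the
causal domain). [folklore] -/
def mixedPoint (y : Fin p → EuclideanSpace ℝ (Fin (d + 1))) (τ : Fin p → ℝ) :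
    Fin p → Fin (d + 1) → ℂ :=
  fun k μ => if μ = 0 then (τ k : ℂ) + I * (y k 0 : ℂ) else (y k μ : ℂ)

/-- `M(y, 0) = ι y`. [folklore] -/
theorem mixedPoint_zero (y : Fin p → EuclideanSpace ℝ (Fin (d + 1))) :
    mixedPoint y 0 = euclideanPoint y := by
  funext k μ
  by_cases hμ : μ = 0
  · subst hμ; simp [mixedPoint]
  · simp [mixedPoint, euclideanPoint, hμ]

/-- Imaginary parts of a mixed point: `Im M(y, τ)_k = y⁰_k ê₀`. [folklore] -/
theorem imPart_mixedPoint (y : Fin p → EuclideanSpace ℝ (Fin (d + 1))) (τ : Fin p → ℝ) (k : Fin p) :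
    imPart (mixedPoint y τ k) = (y k 0) • e₀ d := by
  ext μ
  by_cases hμ : μ = 0
  · subst hμ; simp [mixedPoint, e₀]
  · simp [mixedPoint, hμ, e₀]

/-- The **OS difference variable** `δ_r = (y⁰_r − y⁰_{r-1}) − i (τ_r − τ_{r-1})` of the mixed
point `M(y, τ)` (with `y_{-1} = τ_{-1} = 0`; set to `0` when `r ≥ p`). [folklore] -/
def osDiff (r : ℕ) (y : Fin p → EuclideanSpace ℝ (Fin (d + 1))) (τ : Fin p → ℝ) : ℂ :=
  if h : r < p then ((succDiff (fun k => y k 0) ⟨r, h⟩ : ℝ) : ℂ) - I * ((succDiff τ ⟨r, h⟩ : ℝ) : ℂ)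
  else 0

/-- The tail direction `i 𝟙_{k ≥ r} ê₀` along which the `r`-th difference variable is varied. [folklore] -/
def tailDir (r p : ℕ) : Fin p → Fin (d + 1) → ℂ :=
  fun k μ => if μ = 0 ∧ r ≤ (k : ℕ) then I else 0

/-- The **stage point** `pt_r(y, τ, s) = M(y, τ) + (s − δ_r) • i 𝟙_{k ≥ r} ê₀`: the mixed point
with its `r`-th OS difference variable replaced by `s` (all later `u_k` shifted along). [folklore] -/
def stagePoint (r : ℕ) (y : Fin p → EuclideanSpace ℝ (Fin (d + 1))) (τ : Fin p → ℝ) (s : ℂ) :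
    Fin p → Fin (d + 1) → ℂ :=
  mixedPoint y τ + (s - osDiff r y τ) • tailDir (d := d) r p

/-- The stage point is affine in `s`: `pt_r(s) = pt_r(0) + s • i 𝟙_{≥ r} ê₀`. [folklore] -/
theorem stagePoint_eq_add_smul (r : ℕ) (y : Fin p → EuclideanSpace ℝ (Fin (d + 1))) (τ : Fin p → ℝ)
    (s : ℂ) : stagePoint r y τ s = stagePoint r y τ 0 + s • tailDir (d := d) r p := by
  simp only [stagePoint, zero_sub, sub_smul, neg_smul]
  abel

/-- Imaginary-time profile of a stage point:
`Im pt_r(y, τ, s)_k = (y⁰_k + 𝟙_{k ≥ r} (Re s − Re δ_r)) ê₀`. [folklore] -/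
theorem imPart_stagePoint (r : ℕ) (y : Fin p → EuclideanSpace ℝ (Fin (d + 1))) (τ : Fin p → ℝ)
    (s : ℂ) (k : Fin p) :
    imPart (stagePoint r y τ s k) =
      (y k 0 + if r ≤ (k : ℕ) then (s - osDiff r y τ).re else 0) • e₀ d := by
  ext μ
  simp only [stagePoint, Pi.add_apply, Pi.smul_apply, imPart_apply, smul_eq_mul, tailDir,
    PiLp.smul_apply, e₀_apply]
  by_cases hμ : μ = 0
  · subst hμ
    simp only [mixedPoint, if_true, true_and]
    split_ifs with hr <;> simp
  · simp [mixedPoint, hμ]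

/-- The successive differences of the stage-point profile: those of `y⁰`, except the `r`-th,
which is shifted by `Re s − Re δ_r`. [folklore] -/
theorem succDiff_profile_stagePoint (r : ℕ) (y : Fin p → EuclideanSpace ℝ (Fin (d + 1)))
    (c : ℝ) (k : Fin p) :
    succDiff (fun j : Fin p => y j 0 + if r ≤ (j : ℕ) then c else 0) k =
      succDiff (fun j => y j 0) k + if r = (k : ℕ) then c else 0 := by
  cases p with
  | zero => exact k.elim0
  | succ m =>
    refine Fin.cases ?_ (fun j => ?_) k
    · simp only [succDiff_zero, Fin.val_zero, nonpos_iff_eq_zero]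
      by_cases hr : r = 0 <;> simp [hr]
    · simp only [succDiff_succ, Fin.val_succ, Fin.val_castSucc]
      by_cases h1 : r ≤ (j : ℕ)
      · have h2 : r ≤ (j : ℕ) + 1 := by omega
        have h3 : r ≠ (j : ℕ) + 1 := by omega
        rw [if_pos h1, if_pos h2, if_neg h3]
        ring
      · by_cases h2 : r = (j : ℕ) + 1
        · have h4 : r ≤ (j : ℕ) + 1 := by omega
          rw [if_neg h1, if_pos h4, if_pos h2]
          ring
        · have h4 : ¬ r ≤ (j : ℕ) + 1 := by omega
          rw [if_neg h1, if_neg h4, if_neg h2]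
          ring

/-- For time-ordered `y` and `Re s > 0` the stage-point profile has positive successive
differences (the `r`-th one being `Re s` when `succDiff τ r = 0`, or in general
`Re s + (y-difference) − Re δ_r = Re s`). [folklore] -/
theorem succDiff_profile_stagePoint_pos {r : ℕ} {y : Fin p → EuclideanSpace ℝ (Fin (d + 1))}
    (hy : y ∈ timeOrderedRegion d p) (τ : Fin p → ℝ) {s : ℂ} (hs : 0 < s.re) (k : Fin p) :
    0 < succDiff (fun j : Fin p => y j 0 + if r ≤ (j : ℕ) then (s - osDiff r y τ).re else 0) k := by
  rw [succDiff_profile_stagePoint]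
  by_cases hrk : r = (k : ℕ)
  · rw [if_pos hrk]
    have hrp : r < p := hrk ▸ k.2
    have hk : (⟨r, hrp⟩ : Fin p) = k := Fin.ext hrk
    simp only [osDiff, dif_pos hrp, sub_re, ofReal_re, mul_re, I_re, I_im, ofReal_im, zero_mul,
      one_mul, sub_zero, hk]
    linarith [succDiff_time_pos hy k]
  · rw [if_neg hrk, add_zero]
    exact succDiff_time_pos hy k

/-- **Stage points lie in the forward tube** for time-ordered `y` and `Re s > 0`. [folklore] -/
theorem stagePoint_mem_forwardTube {r : ℕ} {y : Fin p → EuclideanSpace ℝ (Fin (d + 1))}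
    (hy : y ∈ timeOrderedRegion d p) (τ : Fin p → ℝ) {s : ℂ} (hs : 0 < s.re) :
    stagePoint r y τ s ∈ forwardTube d p := by
  have h := strictMono_and_pos_of_succDiff_pos (succDiff_profile_stagePoint_pos (r := r) hy τ hs)
  exact mem_forwardTube_of_imPart_eq (fun k => imPart_stagePoint r y τ s k) h.1 h.2

end Mixed

/-! ### Appending and conjugate-reversing: algebra and profiles -/

section AppendAlgebra

variable {p q : ℕ}

/-- `revConj` is additive. [folklore] -/
theorem revConj_add (z w : Fin p → Fin (d + 1) → ℂ) : revConj (z + w) = revConj z + revConj w := by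
  funext k μ; simp

/-- `Fin.append` is additive in both blocks. [folklore] -/
theorem append_add_append {α : Type*} [Add α] (a b : Fin p → α) (c e : Fin q → α) :
    Fin.append (a + b) (c + e) = Fin.append a c + Fin.append b e := by
  funext k
  induction k using Fin.addCases with
  | left i => simp [Fin.append_left]
  | right j => simp [Fin.append_right]

/-- `Fin.append` splits as the sum of its two blocks padded by zero. [folklore] -/
theorem append_eq_add {α : Type*} [AddZeroClass α] (a : Fin p → α) (c : Fin q → α) :
    Fin.append a c = Fin.append a 0 + Fin.append 0 c := by
  funext k
  induction k using Fin.addCases with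
  | left i => simp [Fin.append_left]
  | right j => simp [Fin.append_right]

/-- Scalars pull out of a zero-padded left block. [folklore] -/
theorem append_smul_zero {R α : Type*} [Zero α] [SMulZeroClass R α] (s : R) (a : Fin p → α) :
    Fin.append (s • a) (0 : Fin q → α) = s • Fin.append a 0 := by
  funext k
  induction k using Fin.addCases with
  | left i => simp [Fin.append_left]
  | right j => simp [Fin.append_right]

/-- Scalars pull out of a zero-padded right block. [folklore] -/
theorem append_zero_smul {R α : Type*} [Zero α] [SMulZeroClass R α] (s : R) (c : Fin q → α) :
    Fin.append (0 : Fin p → α) (s • c) = s • Fin.append 0 c := by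
  funext k
  induction k using Fin.addCases with
  | left i => simp [Fin.append_left]
  | right j => simp [Fin.append_right]

/-- **Appended conjugate-reversed configurations lie in the relative tube** when both pieces
have positive, strictly increasing imaginary-time profiles along `ê₀`: the profile of
`(revConj z, w)` is `(−a_{p-1}, …, −a_0, b_0, …, b_{q-1})`, strictly increasing. [folklore] -/
theorem append_revConj_mem_relForwardTube_of_imPart_eq {z : Fin p → Fin (d + 1) → ℂ}
    {w : Fin q → Fin (d + 1) → ℂ} {a : Fin p → ℝ} {b : Fin q → ℝ}
    (hz : ∀ k, imPart (z k) = a k • e₀ d) (hw : ∀ k, imPart (w k) = b k • e₀ d)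
    (ha : StrictMono a) (ha0 : ∀ k, 0 < a k) (hb : StrictMono b) (hb0 : ∀ k, 0 < b k) :
    Fin.append (revConj z) w ∈ relForwardTube d (p + q) := by
  refine mem_relForwardTube_of_imPart_eq (t := Fin.append (fun i => -a (Fin.rev i)) b)
    (fun k => ?_) (strictMono_fin_append (fun i j hij => ?_) hb (fun i j => ?_))
  · induction k using Fin.addCases with
    | left i => rw [Fin.append_left, Fin.append_left, imPart_revConj, hz, neg_smul]
    | right j => rw [Fin.append_right, Fin.append_right, hw]
  · exact neg_lt_neg (ha (Fin.rev_lt_rev.2 hij))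
  · linarith [ha0 (Fin.rev i), hb0 j]

end AppendAlgebra

/-! ### Stage sets, stage parameters, and the two inclusions -/

section Stages

variable {p : ℕ}

variable (d) in
/-- The **stage-`r` set** `𝒫_r`: mixed points `M(y, τ)` of all degrees with `y` time-ordered and
`τ_k = τ_{k-1}` for `k ≥ r` (`τ_{-1} = 0`), i.e. whose OS difference variables `δ_k`, `k ≥ r`,
are real. `𝒫_0` consists of Euclidean points. [folklore] -/
def stageSet (r : ℕ) : Set (Σ n, (Fin n → Fin (d + 1) → ℂ)) :=
  {P | ∃ y ∈ timeOrderedRegion d P.1, ∃ τ : Fin P.1 → ℝ,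
    (∀ k : Fin P.1, r ≤ (k : ℕ) → succDiff τ k = 0) ∧ P.2 = mixedPoint y τ}

variable (d) in
/-- The set of **mixed points** `M(y, τ)` of all degrees, `y` time-ordered, `τ` arbitrary: the
real-spatial slice of the disjoint union of the forward tubes. [folklore] -/
def mixedPts : Set (Σ n, (Fin n → Fin (d + 1) → ℂ)) :=
  {P | ∃ y ∈ timeOrderedRegion d P.1, ∃ τ : Fin P.1 → ℝ, P.2 = mixedPoint y τ}

/-- `𝒫_0 ⊆` Euclidean points. [folklore] -/
theorem stageSet_zero_subset_euclidPts : stageSet d 0 ⊆ euclidPts d := by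
  rintro ⟨n, z⟩ ⟨y, hy, τ, hτ, hz⟩
  dsimp only at y hy τ hτ hz
  subst hz
  have h0 : τ = 0 := eq_zero_of_succDiff_eq_zero fun k => hτ k (Nat.zero_le _)
  exact ⟨y, hy, by simp only [h0, mixedPoint_zero]⟩

/-- A mixed point of degree `≤ r` lies in `𝒫_r` (no constraint). [folklore] -/
theorem mem_stageSet_of_le {r : ℕ} {P : Σ n, (Fin n → Fin (d + 1) → ℂ)} (hP : P ∈ mixedPts d)
    (hr : P.1 ≤ r) : P ∈ stageSet d r := by
  obtain ⟨y, hy, τ, hτ⟩ := hP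
  exact ⟨y, hy, τ, fun k hk => absurd (lt_of_lt_of_le k.2 hr) (not_lt.2 hk), hτ⟩

variable (d) in
/-- The **stage-`r` parameters**: degree, time-ordered Euclidean data `y`, and real times `τ`
constant from index `r - 1` on. [folklore] -/
def StageParam (r : ℕ) : Type :=
  {P : Σ n, (Fin n → EuclideanSpace ℝ (Fin (d + 1))) × (Fin n → ℝ) //
    P.2.1 ∈ timeOrderedRegion d P.1 ∧ ∀ k : Fin P.1, r ≤ (k : ℕ) → succDiff P.2.2 k = 0}

/-- The stage embedding `(P, s) ↦ ⟨p, pt_r(y, τ, s)⟩`. [folklore] -/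
def stageEmb (r : ℕ) (a : StageParam d r × ℂ) : Σ n, (Fin n → Fin (d + 1) → ℂ) :=
  ⟨a.1.1.1, stagePoint r a.1.1.2.1 a.1.1.2.2 a.2⟩

/-- For stage-`r` parameters the `r`-th OS difference variable is real (`= y⁰_r − y⁰_{r-1}`). [folklore] -/
theorem osDiff_im_eq_zero {r : ℕ} (P : StageParam d r) :
    (osDiff r P.1.2.1 P.1.2.2).im = 0 := by
  unfold osDiff
  split_ifs with h
  · have := P.2.2 ⟨r, h⟩ le_rfl
    simp [this]
  · simp

/-- **Real stage points are stage-`r` points**: for `s = σ > 0` real,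
`pt_r(y, τ, σ) = M(y', τ)` with `y'⁰_k = y⁰_k + 𝟙_{k ≥ r}(σ − δ_r)` time-ordered. [folklore] -/
theorem stageEmb_mem_stageSet_of_real {r : ℕ} (a : StageParam d r × ℂ) (hre : 0 < a.2.re)
    (him : a.2.im = 0) : stageEmb r a ∈ stageSet d r := by
  obtain ⟨⟨⟨n, y, τ⟩, hy, hτ⟩, s⟩ := a
  simp only at hy hτ hre him
  show (⟨n, stagePoint r y τ s⟩ : Σ n, (Fin n → Fin (d + 1) → ℂ)) ∈ stageSet d r
  set c : ℝ := (s - osDiff r y τ).re with hc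
  have hreal : s - osDiff r y τ = (c : ℂ) := by
    apply Complex.ext
    · simp [hc]
    · have h1 := osDiff_im_eq_zero (⟨⟨n, y, τ⟩, hy, hτ⟩ : StageParam d r)
      simp only at h1
      simp [him, h1]
  set y' : Fin n → EuclideanSpace ℝ (Fin (d + 1)) :=
    fun k => y k + EuclideanSpace.single 0 (if r ≤ (k : ℕ) then c else 0) with hy'
  have hy'0 : ∀ k, y' k 0 = y k 0 + if r ≤ (k : ℕ) then c else 0 := fun k => by simp [hy']
  have hy'μ : ∀ k (μ : Fin (d + 1)), μ ≠ 0 → y' k μ = y k μ := fun k μ hμ => by simp [hy', hμ]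
  refine ⟨y', ?_, τ, hτ, ?_⟩
  · refine mem_timeOrderedRegion_of_succDiff_pos fun k => ?_
    have := succDiff_profile_stagePoint_pos (r := r) hy τ hre k
    simp only [← hc] at this
    convert this using 2
    funext j
    exact hy'0 j
  · show stagePoint r y τ s = mixedPoint y' τ
    funext k μ
    simp only [stagePoint, Pi.add_apply, Pi.smul_apply, smul_eq_mul, hreal, tailDir, mixedPoint]
    by_cases hμ : μ = 0
    · subst hμ
      rw [if_pos rfl, if_pos rfl, hy'0]
      simp only [true_and]
      split_ifs with hrk
      · push_cast; ring
      · push_cast; ring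
    · rw [if_neg hμ, if_neg hμ, hy'μ k μ hμ]
      simp [hμ]

/-- Truncation of the real times at index `r`: keep `τ_k` for `k < r`, continue with the constant
`τ_{r-1}` (or `0` if `r = 0`). [folklore] -/
def truncTail (r : ℕ) (τ : Fin p → ℝ) : Fin p → ℝ :=
  fun k => if (k : ℕ) < r then τ k else if h : 0 < r ∧ r ≤ p then τ ⟨r - 1, by omega⟩ else 0

/-- Below `r` the truncation agrees with `τ`. [folklore] -/
theorem truncTail_of_lt {r : ℕ} (τ : Fin p → ℝ) {k : Fin p} (hk : (k : ℕ) < r) :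
    truncTail r τ k = τ k := by
  simp [truncTail, hk]

/-- The truncation has vanishing successive differences from index `r` on. [folklore] -/
theorem succDiff_truncTail_eq_zero {r : ℕ} (τ : Fin p → ℝ) (k : Fin p) (hk : r ≤ (k : ℕ)) :
    succDiff (truncTail r τ) k = 0 := by
  cases p with
  | zero => exact k.elim0
  | succ m =>
    revert hk
    refine Fin.cases ?_ (fun j => ?_) k
    · intro hk
      have hr : r = 0 := by simpa using hk
      simp [truncTail, hr]
    · intro hk
      rw [succDiff_succ]
      simp only [Fin.val_succ] at hk
      by_cases hj : (j : ℕ) < r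
      · -- then `r = j + 1`
        have hr : r = (j : ℕ) + 1 := by omega
        have h1 : truncTail r τ j.succ = τ ⟨r - 1, by omega⟩ := by
          simp only [truncTail, Fin.val_succ, show ¬ ((j : ℕ) + 1 < r) by omega, if_false]
          rw [dif_pos ⟨by omega, by omega⟩]
        have h2 : truncTail r τ j.castSucc = τ j.castSucc :=
          truncTail_of_lt τ (k := j.castSucc) (by simpa using hj)
        rw [h1, h2, sub_eq_zero]
        congr 1
        exact Fin.ext (by simp [hr])
      · simp only [truncTail, Fin.val_succ, Fin.val_castSucc, show ¬ ((j : ℕ) + 1 < r) by omega,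
          hj, if_false, sub_self]

/-- The truncation below `r` has the same successive differences as `τ`. [folklore] -/
theorem succDiff_truncTail_of_lt {r : ℕ} (τ : Fin p → ℝ) (k : Fin p) (hk : (k : ℕ) < r) :
    succDiff (truncTail r τ) k = succDiff τ k := by
  cases p with
  | zero => exact k.elim0
  | succ m =>
    revert hk
    refine Fin.cases ?_ (fun j => ?_) k
    · intro hk; simp [truncTail_of_lt τ hk]
    · intro hk
      rw [succDiff_succ, succDiff_succ, truncTail_of_lt τ hk,
        truncTail_of_lt τ (k := j.castSucc) (by simp only [Fin.val_succ] at hk; simp; omega)]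

/-- **Stage-`(r+1)` points are complex stage points over stage-`r` parameters**:
`M(y, τ) = pt_r(y, τ̃, δ_r(y, τ))` with the truncated times `τ̃` and `Re δ_r > 0`. [folklore] -/
theorem stageSet_succ_subset_image (r : ℕ) :
    stageSet d (r + 1) ⊆ stageEmb r '' {a : StageParam d r × ℂ | 0 < a.2.re} := by
  rintro ⟨n, z⟩ ⟨y, hy, τ, hτ, hz⟩
  dsimp only at y hy τ hτ hz
  subst hz
  by_cases hrn : r < n
  · -- the parameter `(y, τ̃)` and `s = δ_r(y, τ)`
    set τ' := truncTail r τ with hτ'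
    have hP : y ∈ timeOrderedRegion d n ∧ ∀ k : Fin n, r ≤ (k : ℕ) → succDiff τ' k = 0 :=
      ⟨hy, fun k hk => succDiff_truncTail_eq_zero τ k hk⟩
    set s : ℂ := osDiff r y τ with hs
    have hsre : 0 < s.re := by
      simp only [hs, osDiff, dif_pos hrn, sub_re, ofReal_re, mul_re, I_re, I_im, ofReal_im,
        zero_mul, one_mul, sub_zero]
      simpa using succDiff_time_pos hy ⟨r, hrn⟩
    refine ⟨(⟨⟨n, y, τ'⟩, hP⟩, s), hsre, ?_⟩
    simp only [stageEmb]
    congr 1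
    -- `pt_r(y, τ̃, s) = M(y, τ)`
    have hdiff : s - osDiff r y τ' = -I * ((succDiff τ ⟨r, hrn⟩ : ℝ) : ℂ) := by
      simp only [hs, hτ', osDiff, dif_pos hrn, succDiff_truncTail_eq_zero τ ⟨r, hrn⟩ le_rfl]
      push_cast; ring
    have htail : ∀ k : Fin n, r ≤ (k : ℕ) → τ' k + succDiff τ ⟨r, hrn⟩ = τ k := by
      intro k hk
      -- `τ k = τ r` by constancy from `r` on, and `τ̃ k = τ_{r-1}` (or `0`)
      have hk1 : τ k = τ ⟨r, hrn⟩ :=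
        apply_eq_of_succDiff_eq_zero hτ (Fin.le_def.2 (by simpa using hk)) (by simp)
      rw [hk1]
      cases n with
      | zero => exact k.elim0
      | succ m =>
        have hk' : ¬ ((k : ℕ) < r) := not_lt.2 hk
        by_cases hr0 : 0 < r
        · have hval : (⟨r, hrn⟩ : Fin (m + 1)) = (⟨r - 1, by omega⟩ : Fin m).succ :=
            Fin.ext (by simp; omega)
          rw [hval, succDiff_succ]
          simp only [hτ', truncTail, hk', if_false, dif_pos (And.intro hr0 hrn.le)]
          have : (⟨r - 1, by omega⟩ : Fin m).castSucc = ⟨r - 1, by omega⟩ := Fin.ext (by simp)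
          rw [this]; ring
        · have hr : r = 0 := by omega
          subst hr
          have hval : (⟨0, hrn⟩ : Fin (m + 1)) = 0 := rfl
          rw [hval, succDiff_zero]
          simp [hτ', truncTail]
    funext k μ
    simp only [stagePoint, Pi.add_apply, Pi.smul_apply, smul_eq_mul, hdiff, tailDir, mixedPoint]
    by_cases hμ : μ = 0
    · subst hμ
      simp only [if_true, true_and]
      by_cases hk : r ≤ (k : ℕ)
      · rw [if_pos hk, ← htail k hk]
        push_cast
        linear_combination (-((succDiff τ ⟨r, hrn⟩ : ℝ) : ℂ)) * I_mul_I
      · rw [if_neg hk, hτ', truncTail_of_lt τ (not_le.1 hk)]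
        ring
    · simp [hμ]
  · -- degree `≤ r`: no constraint, `s = 1`
    have hP : y ∈ timeOrderedRegion d n ∧ ∀ k : Fin n, r ≤ (k : ℕ) → succDiff τ k = 0 :=
      ⟨hy, fun k hk => absurd (lt_of_lt_of_le k.2 (not_lt.1 hrn)) (not_lt.2 hk)⟩
    refine ⟨(⟨⟨n, y, τ⟩, hP⟩, 1), by simp, ?_⟩
    simp only [stageEmb]
    congr 1
    funext k μ
    have hk : ¬ r ≤ (k : ℕ) := fun h => absurd (lt_of_lt_of_le k.2 (not_lt.1 hrn)) (not_lt.2 h)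
    simp [stagePoint, tailDir, hk]

end Stages

/-! ### Propagation by Glaser's lemma -/

section Propagation

variable {p q : ℕ}

/-- Positive-semidefiniteness of a pulled-back kernel gives positive-semidefiniteness on the
image. [folklore] -/
theorem _root_.Literature.Analysis.Complex.IsPosSemidefKernelOn.of_comp_image {α β : Type*}
    {K : α → α → ℂ} {f : β → α} {B : Set β}
    (h : IsPosSemidefKernelOn (fun x y => K (f x) (f y)) B) : IsPosSemidefKernelOn K (f '' B) := by
  intro m x hx c
  choose b hb hbx using hx
  have := h m b hb c
  simpa only [hbx] using this

/-- **The appended stage configuration is affine in the two complexified variables**: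
`(revConj pt_r(y, τ, conj s̃), pt_r(y', τ', s')) = A + s̃ • v₁ + s' • v₂`. [folklore] -/
theorem append_revConj_stagePoint_eq (r : ℕ) (y : Fin p → EuclideanSpace ℝ (Fin (d + 1)))
    (τ : Fin p → ℝ) (y' : Fin q → EuclideanSpace ℝ (Fin (d + 1))) (τ' : Fin q → ℝ) (s₁ s₂ : ℂ) :
    Fin.append (revConj (stagePoint r y τ (conj s₁))) (stagePoint r y' τ' s₂) =
      Fin.append (revConj (stagePoint r y τ 0)) (stagePoint r y' τ' 0) +
        s₁ • Fin.append (revConj (tailDir (d := d) r p)) 0 +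
        s₂ • Fin.append 0 (tailDir (d := d) r q) := by
  rw [stagePoint_eq_add_smul r y τ (conj s₁), stagePoint_eq_add_smul r y' τ' s₂, revConj_add,
    revConj_smul, Complex.conj_conj, append_add_append,
    append_eq_add (s₁ • revConj (tailDir r p)) (s₂ • tailDir r q), append_smul_zero, append_zero_smul]
  abel

/-- The appended stage configuration lies in the relative tube when both difference variables
have positive real part (time-ordered data). [folklore] -/
theorem append_revConj_stagePoint_mem_relForwardTube {r : ℕ}
    {y : Fin p → EuclideanSpace ℝ (Fin (d + 1))} (hy : y ∈ timeOrderedRegion d p) (τ : Fin p → ℝ)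
    {y' : Fin q → EuclideanSpace ℝ (Fin (d + 1))} (hy' : y' ∈ timeOrderedRegion d q) (τ' : Fin q → ℝ)
    {s s' : ℂ} (hs : 0 < s.re) (hs' : 0 < s'.re) :
    Fin.append (revConj (stagePoint r y τ s)) (stagePoint r y' τ' s') ∈ relForwardTube d (p + q) := by
  have h1 := strictMono_and_pos_of_succDiff_pos (succDiff_profile_stagePoint_pos (r := r) hy τ hs)
  have h2 := strictMono_and_pos_of_succDiff_pos (succDiff_profile_stagePoint_pos (r := r) hy' τ' hs')
  exact append_revConj_mem_relForwardTube_of_imPart_eq (fun k => imPart_stagePoint r y τ s k)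
    (fun k => imPart_stagePoint r y' τ' s' k) h1.1 h1.2 h2.1 h2.2

variable [NeZero d] {S : SchwingerFamily (EuclideanSpace ℝ (Fin (d + 1)))}

/-- **Step 2 of the Glaser route, stage by stage**: the OS kernel is positive-semidefinite on
every stage set `𝒫_r` (induction on `r`: `𝒫_0` is Step 1; `𝒫_r ⇒ 𝒫_{r+1}` is Glaser's lemma
applied to the `r`-th OS difference variable, the other variables being parameters). [cite: GlaserCMP1974, §2] -/
theorem isPosSemidefKernelOn_osKernel_stageSet (hE1 : S.IsEuclideanCovariant)
    (hE2 : S.IsOSReflectionPositive) (𝔚 : (n : ℕ) → (Fin n → Fin (d + 1) → ℂ) → ℂ)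
    (h𝔚 : ∀ n, DifferentiableOn ℂ (𝔚 n) (forwardTube d n))
    (hS : ∀ n (F : 𝓢((Fin n → EuclideanSpace ℝ (Fin (d + 1))), ℂ)), IsTimeOrdered F →
      S n F = ∫ x, 𝔚 n (euclideanPoint x) * F x) (r : ℕ) :
    IsPosSemidefKernelOn (osKernel 𝔚) (stageSet d r) := by
  have hinv : ∀ n, ∀ s : ℝ, 0 ≤ s → ∀ z ∈ forwardTube d n, 𝔚 n (z + iTimeShift d n s) = 𝔚 n z :=
    fun n => eqOn_forwardTube_add_iTimeShift hE1 (h𝔚 n) (hS n)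
  induction r with
  | zero =>
    exact (isPosSemidefKernelOn_osKernel_euclidPts hE1 hE2 𝔚 h𝔚 hS).mono
      stageSet_zero_subset_euclidPts
  | succ r ih =>
    have hG : IsPosSemidefKernelOn
        (fun a b : StageParam d r × ℂ => osKernel 𝔚 (stageEmb r a) (stageEmb r b))
        {a | 0 < a.2.re} := by
      refine isPosSemidefKernelOn_halfPlane_of_ofReal
        (k := fun P P' s₁ s₂ => osKernel 𝔚 (stageEmb r (P, conj s₁)) (stageEmb r (P', s₂)))
        (fun P P' => ?_) (fun P P' s s' _ _ => by simp) ?_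
      · -- sesqui-holomorphy: `𝔚ext` of an affine family in the relative tube
        obtain ⟨⟨p, y, τ⟩, hy, hτ⟩ := P
        obtain ⟨⟨q, y', τ'⟩, hy', hτ'⟩ := P'
        have hW := differentiableOn_tubeExtension (h𝔚 (p + q)) (hinv (p + q))
        refine (hasLocalTaylor₂_comp_affine hW isOpen_relForwardTube
          (Fin.append (revConj (stagePoint r y τ 0)) (stagePoint r y' τ' 0))
          (Fin.append (revConj (tailDir (d := d) r p)) 0) (Fin.append 0 (tailDir (d := d) r q))
          (U := {z : ℂ | 0 < z.re}) (V := {z : ℂ | 0 < z.re})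
          (fun s₁ hs₁ s₂ hs₂ => ?_)).congr (fun s₁ _ s₂ _ => ?_)
        · rw [← append_revConj_stagePoint_eq]
          exact append_revConj_stagePoint_mem_relForwardTube hy τ hy' τ'
            (by simpa using hs₁) hs₂
        · simp only [stageEmb, osKernel]
          rw [append_revConj_stagePoint_eq]
      · -- positivity at the real points: the induction hypothesis
        exact ih.comp (stageEmb r) fun a ha => stageEmb_mem_stageSet_of_real a ha.1 ha.2
    exact (IsPosSemidefKernelOn.of_comp_image hG).mono (stageSet_succ_subset_image r)

/-- **Step 2 of the Glaser route: the OS kernel is positive-semidefinite on all mixed points**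
(V. Glaser (1974), §2: OS positivity of the Schwinger functions propagates by analytic
continuation to the causal domain — here its real-spatial slice, the points
`M(y, τ)_k = (τ_k + i y⁰_k, y⃗_k)` with `y` time-ordered, which contain all the rays `x + i t η`,
`η_k = (k+1) ê₀`). For a Schwinger family with E1, E2 and holomorphic continuations `𝔚ₙ`
reproducing `𝔖ₙ` at Euclidean points, `∑ᵢⱼ conj cᵢ cⱼ 𝔚ext(revConj Pᵢ, Pⱼ) ≥ 0` for every
finite family of mixed points `Pᵢ` (of arbitrary degrees). [cite: GlaserCMP1974, §2] -/
theorem isPosSemidefKernelOn_osKernel_mixedPts (hE1 : S.IsEuclideanCovariant)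
    (hE2 : S.IsOSReflectionPositive) (𝔚 : (n : ℕ) → (Fin n → Fin (d + 1) → ℂ) → ℂ)
    (h𝔚 : ∀ n, DifferentiableOn ℂ (𝔚 n) (forwardTube d n))
    (hS : ∀ n (F : 𝓢((Fin n → EuclideanSpace ℝ (Fin (d + 1))), ℂ)), IsTimeOrdered F →
      S n F = ∫ x, 𝔚 n (euclideanPoint x) * F x) :
    IsPosSemidefKernelOn (osKernel 𝔚) (mixedPts d) := by
  intro m P hP c
  exact isPosSemidefKernelOn_osKernel_stageSet hE1 hE2 𝔚 h𝔚 hS (Finset.univ.sup fun i => (P i).1)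
    m P (fun i => mem_stageSet_of_le (hP i)
      (Finset.le_sup (f := fun i => (P i).1) (Finset.mem_univ i))) c

end Propagation

end Literature.MathematicalPhysics.QuantumFieldTheory
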